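import Summits.BirchSwinnertonDyer.BirchSwinnertonDyer.Theorems.SignedLowerHalvesSmallImageLowerHalfBothSignsRttD2SeqJ3HControl
import Summits.BirchSwinnertonDyer.BirchSwinnertonDyer.Theorems.SignedLowerHalvesSmallImageLowerHalfBothSignsRttD2SeqJ3HLayerSolve
import Summits.BirchSwinnertonDyer.BirchSwinnertonDyer.Theorems.SignedLowerHalvesSmallImageLowerHalfBothSignsRttD2SeqJ3RSeqCofree
import HarnessLib

/-!
# Route `SignedLowerHalves`, crux L `SmallImageLowerHalfBothSigns` (stmt-BirchSwinnertonDyer-23599), line `rtt_w3` v16–v21 — E2, row J3 residual: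
# ★★★ J3 FOR THE LEAD's `M = Cofree θ F` WITHOUT THE HYPOTHESIS `S₀ ⊆ P` — `RSeq` and `hsolL` discharged, and the frame may have `S₀ ⊄ P = supp(p𝔣)`
# (the level-raised bad primes of `W` and the level of `g` need NOT lie in the support of the junction's `P`)

WIDTH seat `bsd-line-slh-p3-w3` g24 under LEAD `cruxlead-stmt-BirchSwinnertonDyer-23599` g12 (cell `bsd-ssimc`); helper `--supports stmt-BirchSwinnertonDyer-23599`.
THEOREMS ONLY (no definition, no named fact, no instance, no `sorry`). WHY THIS FILE: in the LEAD's frame `S₀ = S₀K` (all primes of `K` above the bad primes of `W` and the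
level of `g`) while `P = suppPF p 𝔣 ⊆ supp(𝔪) ∪ {v}` — so `P ∖ S₀ ⊆ {v}` (hPS₀) holds by (R)/(U)+hθ but `S₀ ⊆ P` (hS₀P, used by H7a p800127 and hence by H7b) FAILS whenever
`W` has a bad prime outside `supp(p𝔪)`. The only use of `S₀ ⊆ P` was the descent at places `w ∈ S₀ ∖ P`; there the Poitou–Tate class is STRICT (locally trivial), hence
dies on `U_m ⊓ I_𝔓` by the Shapiro transport of admissibility (`SignedLowerOffTwo.PTDeep.resLe_inertia_eq_zero_of_localization_shapiroLift_mem`). HONEST FRAMING: J3 now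
holds modulo: `K` totally complex; `v` the only place above `p` (`hpv`, `hvp`), non-split (`hv`); `P ∖ S₀ ⊆ {v}`, `v ∈ P`, `v ∉ S₀`, `P`, `S₀` finite; `hNP`; `hMP`; `hinst`;
and `hperf` (perfectness of the level pairings of `cofreeLamCoeffPairingK`). E2, crux L, crux M, BSD remain OPEN and are proved for NO curve.

* ★★★ `exists_mem_strictLevel_locPairNK_eq_of_orth_free` — H7a without `hS₀P`; ★★★ `exists_mem_strictLevel_locPairNK_eq_of_hq_free` — `hsolL` (generic) without `hS₀P`;
* ★★★ `hsolL_cofree_lam_free`, ★★★ `exists_junction_exact_cofree_lam_free` — the `hsolL` binder of p795664 and J3 for `M = Cofree θ F`, without `hS₀P`.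
References: [MilneADT2006] I Thm. 4.10 (b); [NeukirchSchmidtWingberg2008] (8.6.2)–(8.6.3), I §6 (1.6.4), VIII §6; [Kobayashi2003] Thm. 7.3 i); [Rubin2000] Thm. 1.7.3, §4.2;
[Kato2004Asterisque] §17.13.
-/

set_option autoImplicit false
set_option linter.dupNamespace false -- D-0017: single-problem summit, the namespace repeats the problem name by design
noncomputable section

open scoped Classical
open NumberField IsDedekindDomain Field Matrix CategoryTheory Function

namespace Summit.BirchSwinnertonDyer.BirchSwinnertonDyer.Theorems.SmallImageRttD2Seq

open Literature.NumberTheory.EllipticCurves Literature.NumberTheory.EllipticCurves.GreenbergSelmer Literature.NumberTheory.GaloisRepresentations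
  Literature.NumberTheory.GaloisRepresentations.DiscreteGaloisModule Literature.NumberTheory.GaloisCohomology
  Literature.NumberTheory.EllipticCurves.GreenbergVatsal2000 Literature.NumberTheory.ComplexMultiplication.EllipticUnits.JohnsonLeungKings2011
  Summit.BirchSwinnertonDyer.BirchSwinnertonDyer.Theorems.SmallImageCharSignedSelmer Summit.BirchSwinnertonDyer.BirchSwinnertonDyer.Theorems.SmallImageRttD2J1
open Literature.AnabelianGeometry.AbsoluteAnabelian.Prop121vii (zmodToQmodZ zmodToQmodZ_injective)

/-! ## §1. H7a without `S₀ ⊆ P` -/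

section Solve

variable {K : Type} [Field K] [NumberField K] {p : ℕ} [Fact p.Prime] (S : Set (PadicAlgCl p)) [FiniteDimensional ℚ_[p] (padicCoeffField S)] (κ : ZpExtension K p)
  (θ' : absoluteGaloisGroup K →ₜ* (padicCoeffIntegers S)ˣ) (P : Set (HeightOneSpectrum (𝓞 K))) (v : HeightOneSpectrum (𝓞 K))
  (M : Type) [AddCommGroup M] [TopologicalSpace M] [DiscreteTopology M] [DistribMulAction (absoluteGaloisGroup K) M]
  [Module (padicCoeffIntegers S) M]
  (hstabK : ∀ m : M, IsOpen (MulAction.stabilizer (absoluteGaloisGroup K) m : Set (absoluteGaloisGroup K)))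

-- One level assembly of H4 with g22's junction currency: the layer group `H¹(U_{m,v}, M[p^m])` appears in two definitionally equal dialects (`subgroupH1` of the
-- transported action / `subgroupRep (TopRep.res θ (torsRep …).toTopRep)`), whose identification by `rfl` is expensive; hence the raised heartbeat limit.
set_option maxHeartbeats 1600000 in
/-- ★★★ **Finite-level solvability from layer orthogonality, WITHOUT `S₀ ⊆ P`.** Same as H7a's `exists_mem_strictLevel_locPairNK_eq_of_orth` (p800127) minus the
hypothesis `hS₀P : S₀ ⊆ P`: at a place `w ∈ S₀ ∖ P` the class produced by Poitou–Tate is locally TRIVIAL (strict), hence dies on `U_m ⊓ I_𝔓` for every `𝔓 ∣ w` by the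
Shapiro transport of admissibility (`Maps(Γ_K ⧸ U_m, X_m)` is unramified at `w ∉ P`), which is all the descent H1 needs. STATEMENT: for a character `q : E^ε_{sat,v} → ℚ/ℤ` of the saturated local condition group and a level `m`:
if `q` kills the class `res_{m→∞}(torsToH1(θ_{U_m,v}^* c))` for every global `c ∈ H¹(U_m, M[p^m])` unramified off `S₀ ∪ {v}` (zero on `U_m ⊓ I_𝔓`) whose layer
localisation lies in `goodLevel m m` (HYPOTHESIS `horth`, brick H5), then some class `y` of the STRICT set `strictLevel S κ θ′ P S₀ m m` has
`locPairNK … m m y ℓ = q ⟨ℓ⟩` for every `ℓ ∈ goodLevel m m`. Proof: H4 on `Maps(Γ_K ⧸ U_m, X_m)` with `L = goodLevel`, `χ = q/p^m`, then H1 (descent), H6 (strictness)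
and R4 (`θ^* ∘ infl = loc`). [cite: MilneADT2006, Ch. I, Thm. 4.10(b)] [cite: NeukirchSchmidtWingberg2008, (8.6.2)–(8.6.3)] [cite: Kobayashi2003, Thm. 7.3 i)] -/
theorem exists_mem_strictLevel_locPairNK_eq_of_orth_free (V : WeierstrassCurve K) (j : V.geomPrimaryTorsion p →+ M) (S₀ : Set (HeightOneSpectrum (𝓞 K))) (ε : ℤˣ)
    (PG : ∀ k : ℕ, ContPairing (coeffRepK S θ' P k).toTopRep (torsRep M hstabK p k).toTopRep (mu K (p ^ k)).toTopRep)
    (hS₀ : S₀.Finite) (hvS₀ : v ∉ S₀) (hvP : v ∈ P) (hPS₀ : ∀ w ∈ P, w ∉ S₀ → w = v)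
    (hpv : ∀ w : HeightOneSpectrum (𝓞 K), ((p : ℕ) : 𝓞 K) ∈ w.asIdeal → w = v)
    (hNP : ∀ n, ramificationSubgroup K P ≤ κ.layerSubgroup n) (hv : AcSigned.IsNonsplitIn κ v)
    (hstab : letI := localAction (closureEmb (K := K) (v.adicCompletion K)) M
      ∀ m : M, IsOpen (MulAction.stabilizer (absoluteGaloisGroup (v.adicCompletion K)) m : Set (absoluteGaloisGroup (v.adicCompletion K))))
    (q : letI := localAction (closureEmb (K := K) (v.adicCompletion K)) M
      localCondInftySat κ M (padicCoeffIntegers S) V j ε v →+ AddCircle (1 : ℚ))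
    (m : ℕ) (hperf : Bijective fun a : ↥(torsionPow M p m) ↦ (PG m).toLin.flip a)
    (horth : letI := localAction (closureEmb (K := K) (v.adicCompletion K)) M
      ∀ c : subgroupH1 (κ.layerSubgroup m) ↥(torsionPow M p m),
        (∀ w : HeightOneSpectrum (𝓞 K), w ≠ v → w ∉ S₀ → ∀ 𝔓 ∈ w.primesAbove,
          resLe (torsRep M hstabK p m).toTopRep (inf_le_left : κ.layerSubgroup m ⊓ 𝔓.inertia (absoluteGaloisGroup K) ≤ κ.layerSubgroup m) 1 c = 0) →
        ∀ hc : ContinuousCohomology.map (comapSubtypeHom (κ.layerSubgroup m) (resGalOfEmb (closureEmb (K := K) (v.adicCompletion K))))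
            (comapCoeffHom (torsRep M hstabK p m).toTopRep (κ.layerSubgroup m) (resGalOfEmb (closureEmb (K := K) (v.adicCompletion K)))) 1 c ∈
            goodLevel S κ v M V j ε m m,
          q ⟨_, hc⟩ = 0) :
    letI := localAction (closureEmb (K := K) (v.adicCompletion K)) M
    ∃ y ∈ strictLevel S κ θ' P S₀ m m,
      ∀ (ℓ : subgroupH1 (localSubgroupOfEmb (κ.layerSubgroup m) (closureEmb (K := K) (v.adicCompletion K))) ↥(torsionPow M p m))
        (hℓ : ℓ ∈ goodLevel S κ v M V j ε m m),
        locPairNK S κ θ' P v M hstab (fun k ↦ resPairingAt K (p ^ k) (coeffRepK S θ' P k) (torsRep M hstabK p k) (PG k) v) m m y ℓ = q ⟨_, hℓ⟩ := by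
  letI := localAction (closureEmb (K := K) (v.adicCompletion K)) M
  haveI : CompactSpace (absoluteGaloisGroup K) := absoluteGaloisGroup_compactSpace _
  haveI : CompactSpace (absoluteGaloisGroup (v.adicCompletion K)) := absoluteGaloisGroup_compactSpace _
  haveI : NeZero (p ^ m) := ⟨pow_ne_zero _ (Fact.out : p.Prime).ne_zero⟩
  haveI hFin : ∀ n : ℕ, Finite (absoluteGaloisGroup K ⧸ κ.layerSubgroup n) := fun n ↦ by
    haveI : DiscreteTopology (absoluteGaloisGroup K ⧸ κ.layerSubgroup n) := QuotientGroup.discreteTopology (κ.isOpen_layerSubgroup n)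
    exact finite_of_compact_of_discrete
  letI hF : ∀ n : ℕ, Fintype (absoluteGaloisGroup K ⧸ κ.layerSubgroup n) := fun n ↦ Fintype.ofFinite _
  haveI hFI : ∀ n : ℕ, (κ.layerSubgroup n).FiniteIndex := fun n ↦ ⟨by rw [κ.index_layerSubgroup]; exact pow_ne_zero _ (Fact.out : p.Prime).ne_zero⟩
  letI hR : ∀ n : ℕ, Fintype (↥(κ.layerSubgroup n) ⧸ (κ.layerSubgroup (n + 1)).subgroupOf (κ.layerSubgroup n)) := fun n ↦
    @Fintype.ofFinite _ (Subgroup.finite_quotient_of_finiteIndex)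
  haveI : IsClosed (localSubgroupOfEmb (κ.layerSubgroup m) (closureEmb (K := K) (v.adicCompletion K)) : Set (absoluteGaloisGroup (v.adicCompletion K))) :=
    isClosed_localLayer κ v m
  letI : Fintype (absoluteGaloisGroup (v.adicCompletion K) ⧸ localSubgroupOfEmb (κ.layerSubgroup m) (closureEmb (K := K) (v.adicCompletion K))) :=
    fintypeQuotLocalLayer κ v m
  haveI := finite_oMuCarrier (K := K) S m
  -- sections of `Γ_K ⧸ U_m` and `Γ_{K_v} ⧸ U_{m,v}`
  obtain ⟨s, hs, hs1⟩ := exists_reps_one (G := absoluteGaloisGroup K) (κ.layerSubgroup m)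
  obtain ⟨sD, hsD, hsD1⟩ := exists_reps_one (G := absoluteGaloisGroup (v.adicCompletion K))
    (localSubgroupOfEmb (κ.layerSubgroup m) (closureEmb (K := K) (v.adicCompletion K)))
  -- the bi-additive form of the level-`m` pairing and its perfectness
  set B : ↥(Representation.invariants ((muTwistO S θ' m).toRepresentation.comp (ramificationSubgroup K P).subtype)) →+
      ↥(torsionPow M p m) →+ MuCarrier K (p ^ m) := LinearMap.toAddMonoidHom'.comp (PG m).toLin.toAddMonoidHom with hBdef
  have hBapp : ∀ x a, B x a = (PG m).toLin x a := fun _ _ ↦ rfl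
  have hB : ∀ (σ : absoluteGaloisGroup K) (x : ↥(Representation.invariants ((muTwistO S θ' m).toRepresentation.comp (ramificationSubgroup K P).subtype)))
      (a : ↥(torsionPow M p m)), B (coeffRepK S θ' P m σ x) (torsRep M hstabK p m σ a) = mu K (p ^ m) σ (B x a) :=
    fun σ x a ↦ (PG m).toLin_smul σ x a
  have hPG : pairing (coeffRepK S θ' P m) (torsRep M hstabK p m) (mu K (p ^ m)) B hB = PG m :=
    contPairing_eq_of_toLin_eq (LinearMap.ext fun _ ↦ LinearMap.ext fun _ ↦ rfl)
  have hBbij : Bijective fun a : ↥(torsionPow M p m) ↦ B.flip a := by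
    constructor
    · intro a a' h
      apply hperf.1
      exact LinearMap.ext fun x ↦ (DFunLike.congr_fun h x :)
    · intro f
      obtain ⟨a, ha⟩ := hperf.2 f.toIntLinearMap
      exact ⟨a, AddMonoidHom.ext fun x ↦ (LinearMap.congr_fun ha x :)⟩
  -- `X_m` is killed by `p^m`; the places dividing `p^m` lie under `v`; `Maps(Γ_K ⧸ U_m, X_m)` is unramified off `S₀ ∪ {v}`
  have hMn : ∀ x : ↥(Representation.invariants ((muTwistO S θ' m).toRepresentation.comp (ramificationSubgroup K P).subtype)), (p ^ m) • x = 0 :=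
    fun x ↦ by rw [← natCast_zsmul]; exact_mod_cast coeffGSO_torsion S P θ' m x
  have hn : ∀ w : HeightOneSpectrum (𝓞 K), ((p ^ m : ℕ) : 𝓞 K) ∈ w.asIdeal → w ∈ insert v hS₀.toFinset := fun w hw ↦ by
    rw [Nat.cast_pow] at hw
    rw [hpv w (w.isPrime.mem_of_pow_mem m hw)]
    exact Finset.mem_insert_self _ _
  have hurP : ∀ w : HeightOneSpectrum (𝓞 K), w ∉ P →
      GaloisRep.IsUnramifiedAt w (DiscreteGaloisModule.coind (coeffRepK S θ' P m) (κ.layerSubgroup m) (κ.isOpen_layerSubgroup m)) := fun w hwP ↦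
    SignedLowerOffTwo.PTDeep.isUnramifiedAt_coind _ _ _ (isUnramifiedAt_coeffRepK S θ' P m hwP)
      fun 𝔓 h𝔓 ↦ (inertia_le_ramificationSubgroup hwP h𝔓).trans (hNP m)
  have hur : ∀ w : HeightOneSpectrum (𝓞 K), w ∉ insert v hS₀.toFinset →
      GaloisRep.IsUnramifiedAt w (DiscreteGaloisModule.coind (coeffRepK S θ' P m) (κ.layerSubgroup m) (κ.isOpen_layerSubgroup m)) := by
    intro w hw
    have hwv : w ≠ v := fun h ↦ hw (h ▸ Finset.mem_insert_self _ _)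
    have hwS : w ∉ S₀ := fun h ↦ hw (Finset.mem_insert_of_mem (hS₀.mem_toFinset.mpr h))
    exact hurP w fun h ↦ hwv (hPS₀ w h hwS)
  -- ### the good set as a subgroup of `H¹(U_{m,v}, M[p^m])` and the character `χ = q / p^m` on it
  let incl : subgroupH1 (localSubgroupOfEmb (κ.layerSubgroup m) (closureEmb (K := K) (v.adicCompletion K))) ↥(torsionPow M p m) →+
      subgroupH1 (localSubgroupOfEmb κ.kerSubgroup (closureEmb (K := K) (v.adicCompletion K))) M :=
    (resOfLe M (localSubgroupOfEmb_kerSubgroup_le κ v m)).comp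
      (torsToH1 M p (localSubgroupOfEmb (κ.layerSubgroup m) (closureEmb (K := K) (v.adicCompletion K))) m)
  -- the good set, as a subgroup WITHOUT a body and typed in H4's dialect (keeps the two `H¹(U_{m,v}, M[p^m])` dialects from being unfolded against each other)
  obtain ⟨L, hLmem⟩ : ∃ L : AddSubgroup (continuousCohomology 1 (subgroupRep (TopRep.res (resGalOfEmb (closureEmb (K := K) (v.adicCompletion K)) : absoluteGaloisGroup (v.adicCompletion K) →* absoluteGaloisGroup K) (torsRep M hstabK p m).toTopRep)
      ((κ.layerSubgroup m).comap (resGalOfEmb (closureEmb (K := K) (v.adicCompletion K)) : absoluteGaloisGroup (v.adicCompletion K) →* absoluteGaloisGroup K)))),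
      ∀ ℓ, ℓ ∈ L ↔ incl ℓ ∈ localCondInftySat κ M (padicCoeffIntegers S) V j ε v :=
    ⟨(localCondInftySat κ M (padicCoeffIntegers S) V j ε v).comap incl, fun _ ↦ Iff.rfl⟩
  let inclL : L →+ localCondInftySat κ M (padicCoeffIntegers S) V j ε v := (incl.comp L.subtype).codRestrict _ fun ℓ ↦ (hLmem ℓ).mp ℓ.2
  -- `L` is killed by `p^m`
  haveI : CompactSpace ↥(localSubgroupOfEmb (κ.layerSubgroup m) (closureEmb (K := K) (v.adicCompletion K))) :=
    isCompact_iff_compactSpace.mp (isClosed_localLayer κ v m).isCompact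
  have hH1tors : ∀ a : subgroupH1 (localSubgroupOfEmb (κ.layerSubgroup m) (closureEmb (K := K) (v.adicCompletion K))) ↥(torsionPow M p m),
      (p ^ m) • a = 0 := by
    intro a
    obtain ⟨φ, rfl⟩ := oneCocycleClass_surjective
      (discreteTopRep ↥(localSubgroupOfEmb (κ.layerSubgroup m) (closureEmb (K := K) (v.adicCompletion K))) ↥(torsionPow M p m)) a
    have hφ : ((p ^ m : ℕ) : ℤ) • φ = 0 := by
      refine Subtype.ext (ContinuousMap.ext fun g ↦ ?_)
      change ((p ^ m : ℕ) : ℤ) • φ.1 g = 0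
      rw [natCast_zsmul]
      exact Subtype.ext (by rw [AddSubmonoidClass.coe_nsmul]; exact (mem_torsionPow_iff (M := M) (p := p) m _).mp (φ.1 g).2)
    change (p ^ m) • oneCocycleClass _ φ = (0 : ↥(continuousCohomology 1 _))
    rw [← Nat.cast_smul_eq_nsmul ℤ, ← oneCocycleClass_smul, hφ, oneCocycleClass_zero]
  have hLtors : ∀ a : L, (p ^ m) • a = 0 := fun a ↦ Subtype.ext (by rw [AddSubmonoidClass.coe_nsmul]; exact hH1tors a.1)
  obtain ⟨χ, hχE⟩ := PoitouTateFinite.PoitouTateShaTwoReadout.exists_addMonoidHom_zmodToQmodZ_eq hLtors (q.comp inclL)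
  -- ### H4's orthogonality hypothesis from `horth`
  have hχ : ∀ c : continuousCohomology 1 (subgroupRep (torsRep M hstabK p m).toTopRep (κ.layerSubgroup m)),
      (∀ w : HeightOneSpectrum (𝓞 K), w ∉ insert v hS₀.toFinset → ∀ 𝔓 ∈ w.primesAbove,
        resLe (torsRep M hstabK p m).toTopRep (inf_le_left : κ.layerSubgroup m ⊓ 𝔓.inertia (absoluteGaloisGroup K) ≤ κ.layerSubgroup m) 1 c = 0) →
      ∀ hc : ContinuousCohomology.map (comapSubtypeHom (κ.layerSubgroup m) (resGalOfEmb (closureEmb (K := K) (v.adicCompletion K))))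
          (comapCoeffHom (torsRep M hstabK p m).toTopRep (κ.layerSubgroup m) (resGalOfEmb (closureEmb (K := K) (v.adicCompletion K)))) 1 c ∈ L,
        χ ⟨_, hc⟩ = 0 := by
    intro c hcur hc
    apply zmodToQmodZ_injective (p ^ m)
    rw [hχE, map_zero]
    exact horth c (fun w hwv hwS ↦ hcur w fun h ↦ by
      rcases Finset.mem_insert.mp h with h | h
      · exact hwv h
      · exact hwS (hS₀.mem_toFinset.mp h)) ((mem_goodLevel_iff S κ v M V j ε m m _).mpr ((hLmem _).mp hc))
  -- ### H4: Poitou–Tate solvability at the layer `K̄^{U_m}`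
  obtain ⟨y, hyS₀, hyur, hyval⟩ := exists_layer_localPairingSubgroup_eq K (p ^ m) (coeffRepK S θ' P m) (torsRep M hstabK p m) B hB
    (κ.layerSubgroup m) (κ.isOpen_layerSubgroup m) v hBbij hMn hsD hsD1 (quotientMapOfHom_surjective_of_isNonsplitIn κ v hv m) hs hs1
    hS₀.toFinset hn hur L χ hχ
  -- ### H1 + H6 + readout (separate declaration: keeps the elaboration of the two dialects apart)
  refine exists_mem_strictLevel_locPairNK_eq_of_layer_class S κ θ' P v M hstabK V j S₀ ε PG hNP hstab q m hs hs1 y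
    (fun w hw ↦ hyS₀ w (hS₀.mem_toFinset.mpr hw) fun h ↦ hvS₀ (h ▸ hw))
    (fun w hwP 𝔓 h𝔓 ↦ by
      by_cases hwS : w ∈ S₀
      · -- `w ∈ S₀ ∖ P`: the Shapiro lift of `y` is locally TRIVIAL at `w` (strict), and `Maps(Γ_K ⧸ U_m, X_m)` is unramified at `w ∉ P`
        have hne : w ≠ v := fun h ↦ hwP (h ▸ hvP)
        have h0 := hyS₀ w (hS₀.mem_toFinset.mpr hwS) hne
        exact SignedLowerOffTwo.PTDeep.resLe_inertia_eq_zero_of_localization_shapiroLift_mem (coeffRepK S θ' P m) (κ.layerSubgroup m)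
          (κ.isOpen_layerSubgroup m) hs hs1 (hurP w hwP) y (by rw [h0]; exact zero_mem _) h𝔓
      · exact hyur w (fun h ↦ by
          rcases Finset.mem_insert.mp h with h | h
          · exact hwP (h ▸ hvP)
          · exact hwS (hS₀.mem_toFinset.mp h)) 𝔓 h𝔓)
    fun ℓ hℓ ↦ ?_
  have hℓL : ℓ ∈ L := (hLmem ℓ).mpr ((mem_goodLevel_iff S κ v M V j ε m m ℓ).mp hℓ)
  have h1 := hyval ℓ hℓL
  rw [hPG] at h1
  exact (congrArg (zmodToQmodZ (p ^ m)) h1).trans (hχE ⟨ℓ, hℓL⟩)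

/-- ★★★ **`hsolL` at level `m` WITHOUT `S₀ ⊆ P`** (generic `M`, restricted global pairings): §1 + H5b (`horth_of_hq`). [cite: Kobayashi2003, Thm. 7.3 i)]
[cite: MilneADT2006, Ch. I, Thm. 4.10(b)] [cite: Rubin2000, Thm. 1.7.3, §4.2] -/
theorem exists_mem_strictLevel_locPairNK_eq_of_hq_free (V : WeierstrassCurve K) (j : V.geomPrimaryTorsion p →+ M) (S₀ : Set (HeightOneSpectrum (𝓞 K))) (ε : ℤˣ)
    (PG : ∀ k : ℕ, ContPairing (coeffRepK S θ' P k).toTopRep (torsRep M hstabK p k).toTopRep (mu K (p ^ k)).toTopRep)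
    (hS₀ : S₀.Finite) (hvS₀ : v ∉ S₀) (hvP : v ∈ P) (hPS₀ : ∀ w ∈ P, w ∉ S₀ → w = v)
    (hvp : ((p : ℕ) : 𝓞 K) ∈ v.asIdeal) (hpv : ∀ w : HeightOneSpectrum (𝓞 K), ((p : ℕ) : 𝓞 K) ∈ w.asIdeal → w = v)
    (hNP : ∀ n, ramificationSubgroup K P ≤ κ.layerSubgroup n) (hv : AcSigned.IsNonsplitIn κ v)
    (hstab : letI := localAction (closureEmb (K := K) (v.adicCompletion K)) M
      ∀ m : M, IsOpen (MulAction.stabilizer (absoluteGaloisGroup (v.adicCompletion K)) m : Set (absoluteGaloisGroup (v.adicCompletion K))))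
    (q : letI := localAction (closureEmb (K := K) (v.adicCompletion K)) M
      localCondInftySat κ M (padicCoeffIntegers S) V j ε v →+ AddCircle (1 : ℚ))
    (hq : letI := localAction (closureEmb (K := K) (v.adicCompletion K)) M
      ∀ s : signedTransportSelmerInftySat κ M (padicCoeffIntegers S) V j S₀ ε,
        q (locSat κ M (padicCoeffIntegers S) V j S₀ ε v (fun _ _ ↦ rfl) hvp s) = 0)
    (m : ℕ) (hperf : Bijective fun a : ↥(torsionPow M p m) ↦ (PG m).toLin.flip a) :
    letI := localAction (closureEmb (K := K) (v.adicCompletion K)) M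
    ∃ y ∈ strictLevel S κ θ' P S₀ m m,
      ∀ (ℓ : subgroupH1 (localSubgroupOfEmb (κ.layerSubgroup m) (closureEmb (K := K) (v.adicCompletion K))) ↥(torsionPow M p m))
        (hℓ : ℓ ∈ goodLevel S κ v M V j ε m m),
        locPairNK S κ θ' P v M hstab (fun k ↦ resPairingAt K (p ^ k) (coeffRepK S θ' P k) (torsRep M hstabK p k) (PG k) v) m m y ℓ = q ⟨_, hℓ⟩ :=
  exists_mem_strictLevel_locPairNK_eq_of_orth_free S κ θ' P v M hstabK V j S₀ ε PG hS₀ hvS₀ hvP hPS₀ hpv hNP hv hstab q m hperf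
    fun c hcur hc ↦ horth_of_hq S κ v M hstabK V j S₀ ε hvp hpv hv hstab q hq m c hcur hc

end Solve

/-! ## §2. The LEAD's module `M = Cofree θ F`: `hsolL` and J3, without `S₀ ⊆ P` -/

section Cofree

variable {K : Type} [Field K] [NumberField K] {p : ℕ} [Fact p.Prime] {κ : ZpExtension K p} {γ : absoluteGaloisGroup K}
  (S : Set (PadicAlgCl p)) [FiniteDimensional ℚ_[p] (padicCoeffField S)] (lam : padicCoeffIntegers S →+ ℤ_[p])
  (hlam : ∀ (c : ℤ_[p]) (y : padicCoeffIntegers S), lam (padicIntToCoeffIntegers S c * y) = c * lam y)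
  (θ : FramedGaloisRep K (padicCoeffIntegers S) 1)
  {V : WeierstrassCurve K} {j : V.geomPrimaryTorsion p →+ Cofree θ (padicCoeffField S)} {S₀ : Set (HeightOneSpectrum (𝓞 K))} {ε : ℤˣ}
  (D : SignedTransportDualDataSat κ γ (Cofree θ (padicCoeffField S)) (padicCoeffIntegers S) V j S₀ ε)
  {v : HeightOneSpectrum (𝓞 K)} [inst : DistribMulAction (absoluteGaloisGroup (v.adicCompletion K)) (Cofree θ (padicCoeffField S))]
  [SMulCommClass (absoluteGaloisGroup (v.adicCompletion K)) (padicCoeffIntegers S) (Cofree θ (padicCoeffField S))]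
  {γv : absoluteGaloisGroup (v.adicCompletion K)} (DQ : LocalCondDualData κ (Cofree θ (padicCoeffField S)) (padicCoeffIntegers S) V j ε v γv)
  (hres : ∀ (σ : absoluteGaloisGroup (v.adicCompletion K)) (m : Cofree θ (padicCoeffField S)), σ • m = resGalOfEmb (closureEmb (K := K) (v.adicCompletion K)) σ • m)
  (hvp : (p : 𝓞 K) ∈ v.asIdeal)
  {γB : absoluteGaloisGroup K} {θ' : absoluteGaloisGroup K →ₜ* (padicCoeffIntegers S)ˣ} {P : Set (HeightOneSpectrum (𝓞 K))}
  (I : CycIwasawaCohomologyDataO S κ γB θ' P 1)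
  (hstab : ∀ m : Cofree θ (padicCoeffField S),
    IsOpen (MulAction.stabilizer (absoluteGaloisGroup (v.adicCompletion K)) m : Set (absoluteGaloisGroup (v.adicCompletion K))))
  (hθ : ∀ σ : absoluteGaloisGroup K,
    ((θ' σ : (padicCoeffIntegers S)ˣ) : padicCoeffIntegers S) * ((θ σ : GL (Fin 1) (padicCoeffIntegers S)) : Matrix (Fin 1) (Fin 1) (padicCoeffIntegers S)) 0 0 = 1)
  (htor : ∀ m : Cofree θ (padicCoeffField S), ∃ k : ℕ, p ^ k • m = 0)
  (hγB : γB * resGalOfEmb (closureEmb (K := K) (v.adicCompletion K)) γv ∈ κ.kerSubgroup)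
  (hNP : ∀ n, ramificationSubgroup K P ≤ κ.layerSubgroup n) (hv : AcSigned.IsNonsplitIn κ v)

include hNP hv in
/-- ★★★ **`hsolL` FOR `M = Cofree θ F` AND THE `λ`-PAIRINGS, WITHOUT `S₀ ⊆ P`** — the hypothesis `hsolL` of `exists_junction_exact_cofree_lam_of_hsolL` (p795664) VERBATIM (any `hres`, the
instance pinned by `hinst`), from perfectness of the level pairings (`hperf`) and the frame hypotheses. The pairings `cofreeLamCoeffPairing` ARE the restrictions of the global
`cofreeLamCoeffPairingK` (definitionally), so §1 applies. [cite: Kobayashi2003, Thm. 7.3 i)] [cite: MilneADT2006, Ch. I, Thm. 4.10(b)] [cite: Rubin2000, Thm. 1.7.3, §4.2] -/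
theorem hsolL_cofree_lam_free (hinst : inst = localAction (closureEmb (K := K) (v.adicCompletion K)) (Cofree θ (padicCoeffField S)))
    (hstabK : ∀ m : Cofree θ (padicCoeffField S), IsOpen (MulAction.stabilizer (absoluteGaloisGroup K) m : Set (absoluteGaloisGroup K)))
    (hS₀ : S₀.Finite) (hvS₀ : v ∉ S₀) (hvP : v ∈ P) (hPS₀ : ∀ w ∈ P, w ∉ S₀ → w = v)
    (hpv : ∀ w : HeightOneSpectrum (𝓞 K), ((p : ℕ) : 𝓞 K) ∈ w.asIdeal → w = v)
    (hperf : ∀ m : ℕ, Bijective fun a : ↥(torsionPow (Cofree θ (padicCoeffField S)) p m) ↦ (cofreeLamCoeffPairingK S lam hlam θ' P θ hstabK hθ m).toLin.flip a)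
    (q : localCondInftySat κ (Cofree θ (padicCoeffField S)) (padicCoeffIntegers S) V j ε v →+ AddCircle (1 : ℚ))
    (hq : ∀ s : signedTransportSelmerInftySat κ (Cofree θ (padicCoeffField S)) (padicCoeffIntegers S) V j S₀ ε,
      q (locSat κ (Cofree θ (padicCoeffField S)) (padicCoeffIntegers S) V j S₀ ε v hres hvp s) = 0) (m : ℕ) :
    ∃ y ∈ strictLevel S κ θ' P S₀ m m,
      ∀ (ℓ : subgroupH1 (localSubgroupOfEmb (κ.layerSubgroup m) (closureEmb (K := K) (v.adicCompletion K))) ↥(torsionPow (Cofree θ (padicCoeffField S)) p m))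
        (hℓ : ℓ ∈ goodLevel S κ v (Cofree θ (padicCoeffField S)) V j ε m m),
        locPairNK S κ θ' P v (Cofree θ (padicCoeffField S)) hstab (cofreeLamCoeffPairing S lam hlam θ' P v θ hres hstab hθ) m m y ℓ = q ⟨_, hℓ⟩ := by
  subst hinst
  exact exists_mem_strictLevel_locPairNK_eq_of_hq_free S κ θ' P v (Cofree θ (padicCoeffField S)) hstabK V j S₀ ε (cofreeLamCoeffPairingK S lam hlam θ' P θ hstabK hθ)
    hS₀ hvS₀ hvP hPS₀ hvp hpv hNP hv hstab q hq m (hperf m)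

include htor hv in
/-- ★★★ **J3 FOR THE LEAD's `M = Cofree θ F` — `RSeq` AND `hsolL` BOTH DISCHARGED, WITHOUT `S₀ ⊆ P`.** There is `j₀ : B′ →ₗ[Λ_𝒪] DQ.X` on the strict carrier `B′` with
`toDual ∘ j₀ = strictPairing …` and `Function.Exact j₀ gX` (`exists_junction_exact_cofree_lam_seq`, g22 p792377), given ONLY the frame hypotheses: `K` totally complex,
`v` the only place above `p` and non-split in `K_∞`, `P ∖ S₀ ⊆ {v} ⊆ P ∖ S₀`, `P`, `S₀` finite, `K_∞/K` unramified outside `P`, inertia off `P` trivial on `M`, the `Γ_{K_v}`-action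
`localAction`, and perfectness of the level pairings `X_m × M[p^m] → μ_{p^m}` of `cofreeLamCoeffPairingK`. [cite: Kobayashi2003, Thm. 7.3 i)] [cite: Rubin2000, Thm. 1.7.3, §4.2]
[cite: NeukirchSchmidtWingberg2008, VIII §6, (7.2.6)] [cite: MilneADT2006, Ch. I, Thm. 4.10(b)] [cite: Kato2004Asterisque, §17.13] -/
theorem exists_junction_exact_cofree_lam_free [IsTotallyComplex K]
    (hinst : inst = localAction (closureEmb (K := K) (v.adicCompletion K)) (Cofree θ (padicCoeffField S)))
    (instX : Module (IwasawaAlgebraO S) D.X) (instQ : Module (IwasawaAlgebraO S) DQ.X)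
    (hιX : ∀ (f : IwasawaAlgebra p) (x : D.X), (letI := instX; iwasawaToIwasawaO S f • x) = f • x)
    (hιQ : ∀ (f : IwasawaAlgebra p) (x : DQ.X), (letI := instQ; iwasawaToIwasawaO S f • x) = f • x)
    (hCX : ∀ (a : padicCoeffIntegers S) (x : D.X) (s : signedTransportSelmerInftySat κ (Cofree θ (padicCoeffField S)) (padicCoeffIntegers S) V j S₀ ε),
      D.toDual (letI := instX; (PowerSeries.C a : IwasawaAlgebraO S) • x) s =
        D.toDual x ⟨GreenbergSelmer.scalarH1 κ.kerSubgroup (Cofree θ (padicCoeffField S)) a s,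
          scalarH1_mem_signedTransportSelmerInftySat κ (Cofree θ (padicCoeffField S)) (padicCoeffIntegers S) V j S₀ ε a s.2⟩)
    (hCQ : ∀ (a : padicCoeffIntegers S) (x : DQ.X) (c : localCondInftySat κ (Cofree θ (padicCoeffField S)) (padicCoeffIntegers S) V j ε v),
      DQ.toDual (letI := instQ; (PowerSeries.C a : IwasawaAlgebraO S) • x) c = DQ.toDual x (scalarLocalSat κ (Cofree θ (padicCoeffField S)) (padicCoeffIntegers S) V j ε v a c))
    (hstabK : ∀ m : Cofree θ (padicCoeffField S), IsOpen (MulAction.stabilizer (absoluteGaloisGroup K) m : Set (absoluteGaloisGroup K)))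
    (hγ : κ.IsTopGenerator γ) (hγv : κ.IsTopGenerator (resGalOfEmb (closureEmb (K := K) (v.adicCompletion K)) γv)) (hP : P.Finite)
    (hS₀ : S₀.Finite) (hPS₀ : ∀ w ∈ P, w ∉ S₀ → w = v) (hpv : ∀ w : HeightOneSpectrum (𝓞 K), ((p : ℕ) : 𝓞 K) ∈ w.asIdeal → w = v)
    (hMP : ∀ w : HeightOneSpectrum (𝓞 K), w ∉ P → ∀ 𝔓 ∈ w.primesAbove, ∀ τ ∈ 𝔓.inertia (absoluteGaloisGroup K), ∀ m : Cofree θ (padicCoeffField S), τ • m = m)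
    (hvS₀ : v ∉ S₀) (hvP : v ∈ P)
    (hperf : ∀ m : ℕ, Bijective fun a : ↥(torsionPow (Cofree θ (padicCoeffField S)) p m) ↦ (cofreeLamCoeffPairingK S lam hlam θ' P θ hstabK hθ m).toLin.flip a) :
    letI := instX; letI := instQ
    ∃ j₀ : strictCarrier I (strictLevel S κ θ' P S₀) (fun n k f _ hy ↦ smul_mem_strictLevel S κ θ' P S₀ γB n k f hy) →ₗ[IwasawaAlgebraO S] DQ.X,
      (∀ b, DQ.toDual (j₀ b) = strictPairing (layerPairingOf S κ θ' P v (Cofree θ (padicCoeffField S)) hstab (cofreeLamCoeffPairing S lam hlam θ' P v θ hres hstab hθ) htor γB γv hγB hNP hv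
        (cofreeLamCoeffPairing_hPred S lam hlam θ' P v θ hres hstab hθ) (cofreeLamCoeffPairing_hPsc S lam hlam θ' P v θ hres hstab hθ)) I (strictLevel S κ θ' P S₀)
        (fun n k f _ hy ↦ smul_mem_strictLevel S κ θ' P S₀ γB n k f hy) hstab b) ∧
      Function.Exact j₀ (gXLinearMapO S D DQ hres hvp instX instQ hιX hιQ hCX hCQ htor hstabK hstab hγ hv hγv) :=
  exists_junction_exact_cofree_lam_of_hsolL S lam hlam θ D DQ hres hvp I hstab hθ htor hγB hNP hv hinst instX instQ hιX hιQ hCX hCQ hstabK hγ hγv hP hS₀ hPS₀ hpv hMP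
    (hsolL_cofree_lam_free S lam hlam θ hres hvp hstab hθ hNP hv hinst hstabK hS₀ hvS₀ hvP hPS₀ hpv hperf)

end Cofree

end Summit.BirchSwinnertonDyer.BirchSwinnertonDyer.Theorems.SmallImageRttD2Seq

end
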